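import Summits.Ventures.HSemireg.WedgeHankelBoxSiegelIdealSpikes

/-!
# Venture HSemireg — THE BOX SIEGEL IDEAL, test families (2): over an infinite field the TRANSVERSE-PAIR boxes (FN-1's class family
# `A_i e^{λ_iΘ_i} + B_i e^{μ_iΘ_i}`, `A_i, B_i ≠ 0`, `λ_i ≠ μ_i`) detect the box Siegel ideal in every degree; one factor: the transverse pairs detect `SI_k`

HONEST FRAMING. Part of the Lean index of the computation cell `pub-hsemireg` (seat p10 gen 12, Sunday typer «UNIFORM-IN-n»).
Finite-dimensional EXTERIOR ALGEBRA over a field + a Vandermonde argument ONLY: no variety, no cohomology theory, no sheaf, no Ext group, no semiregularity map; nothing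
here says that HC / HC_CM / HC_AV holds; no Literature fact is declared or used.  Custodian versions as in `WedgeHankelBoxSiegelIdeal` (1/3) and FORMULA-N PART A §7 FN-1
(«for every n ≥ 1 and every pair of … transverse-pair Chern characters»); the dictionary (`q_j = Aλ^j + Bμ^j` ↦ `ch(A e^{λΘ} ⊕ B e^{μΘ})`, gen 10's `tpSeq`) is QUOTED, never asserted.

THIS FILE (namespace `Summit.Ventures.HSemireg.Wedge.HankelBoxSiegelIdeal` continued; imports `WedgeHankelBoxSiegelIdealSpikes`):
* §23 LINEARITY of th-7's class in its coefficient sequence (`w_add`, `w_smul`, `w_sum`, `w_congr`: only `q_0, …, q_m` matter) and a VANDERMONDE lemma: over a field with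
  `m + 1` distinct elements every spike `δ_p` agrees on `{0, …, m}` with a combination of geometric sequences (`exists_geom_combination`); the transverse-pair sequences
  of a fixed pair `λ ≠ μ` with two different second coefficients differ by a multiple of a geometric sequence (`tpSeq_sub_tpSeq`).
* §24 ONE FACTOR: **`mem_siegelIdeal_iff_forall_tpSeq`: over an INFINITE field, a `k`-form lies in `SI_k` iff it is killed by `w_m(q)` for every transverse-pair sequence
  `q_j = Aλ^j + Bμ^j` (`A, B ≠ 0`, `λ ≠ μ`)** — FN-1's classes alone see the isotropic part (via gen 11 #4's spike test).
* §25 BOXES: the Hankel box is linear in the class of each factor (`hankelBox_update_sum`, from `prodR_sum_slot`), so by the same Vandermonde step and an induction on the number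
  of free factors **`mem_boxSiegelIdeal_iff_forall_tpBox`: over an infinite field, `θ ∈ boxSiegelIdeal_k ⟺ θ ∧ (v₀ ∧ ⋯ ∧ v_{n−1}) = 0` for every box of TRANSVERSE PAIRS with
  per-factor data `(A_i, B_i, λ_i ≠ μ_i)`** — the common kernel of FN-1's boxes is exactly the box Siegel ideal.
NOT typed (honest): finite fields (the statement needs `≥ max(m_i) + 1` and `≥ 3` elements; `Infinite K` is assumed for simplicity — th-6's statements carry `CharZero`); anything Ext-side.
Class side only.
-/

open Module

namespace Summit.Ventures.HSemireg.Wedge.HankelBoxSiegelIdeal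

open Summit.Ventures.HSemireg.Wedge Summit.Ventures.HSemireg.Wedge.Kunneth Summit.Ventures.HSemireg.Wedge.MixedBox
  Summit.Ventures.HSemireg.Wedge.HankelSiegel Summit.Ventures.HSemireg.Wedge.HankelSiegelIdeal
  Summit.Ventures.HSemireg.Wedge.HankelBox

variable (K : Type*) [Field K]

/-! ## §23. Linearity in the coefficient sequence; geometric sequences; Vandermonde -/

section OneFactor

variable {M : ℕ}

/-- th-7's class is additive in the coefficient sequence. -/
lemma w_add (ρ ρ' : ℕ → K) : Hankel.w K M M (ρ + ρ') = Hankel.w K M M ρ + Hankel.w K M M ρ' := by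
  rw [w_eq_sum_spikes, w_eq_sum_spikes K ρ, w_eq_sum_spikes K ρ', ← Finset.sum_add_distrib]
  exact Finset.sum_congr rfl fun p _ => by rw [Pi.add_apply, add_smul]

/-- th-7's class is homogeneous in the coefficient sequence. -/
lemma w_smul (c : K) (ρ : ℕ → K) : Hankel.w K M M (c • ρ) = c • Hankel.w K M M ρ := by
  rw [w_eq_sum_spikes, w_eq_sum_spikes K ρ, Finset.smul_sum]
  exact Finset.sum_congr rfl fun p _ => by rw [Pi.smul_apply, smul_eq_mul, mul_smul]

/-- th-7's class of a finite linear combination of sequences. -/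
lemma w_sum {ι : Type*} (s : Finset ι) (c : ι → K) (ρ : ι → ℕ → K) :
    Hankel.w K M M (fun t => ∑ l ∈ s, c l * ρ l t) = ∑ l ∈ s, c l • Hankel.w K M M (ρ l) := by
  classical
  induction s using Finset.induction_on with
  | empty =>
    simp only [Finset.sum_empty]
    rw [show (fun _ : ℕ => (0 : K)) = (0 : K) • (fun _ : ℕ => (0 : K)) by funext t; simp, w_smul, zero_smul]
  | insert a s ha ih =>
    rw [Finset.sum_insert ha, ← ih, ← w_smul, ← w_add]
    congr 1
    funext t
    rw [Finset.sum_insert ha, Pi.add_apply, Pi.smul_apply, smul_eq_mul]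

/-- th-7's class only sees `q_0, …, q_m`. -/
lemma w_congr {ρ ρ' : ℕ → K} (h : ∀ t ≤ M, ρ t = ρ' t) : Hankel.w K M M ρ = Hankel.w K M M ρ' := by
  rw [w_eq_sum_spikes, w_eq_sum_spikes K ρ']
  exact Finset.sum_congr rfl fun p hp => by rw [h p (by have := Finset.mem_range.mp hp; omega)]

/-- two transverse-pair sequences with the same exponentials and first coefficient differ by a multiple of a geometric sequence. -/
lemma tpSeq_sub_tpSeq (B B' lam mu : K) : tpSeq K 1 B lam mu - tpSeq K 1 B' lam mu = (B - B') • fun t => mu ^ t := by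
  funext t
  simp only [Pi.sub_apply, tpSeq_apply, Pi.smul_apply, smul_eq_mul]
  ring

/-- **VANDERMONDE**: with `m + 1` distinct elements `μ_0, …, μ_m` the geometric sequences `(μ_l^t)_{t ≤ m}` span everything: every spike `δ_p` agrees on `{0, …, m}` with a
combination of them. -/
theorem exists_geom_combination {μ : Fin (M + 1) → K} (hμ : Function.Injective μ) (p : ℕ) :
    ∃ c : Fin (M + 1) → K, ∀ t ≤ M, (∑ l, c l * μ l ^ t) = if t = p then (1 : K) else 0 := by
  have hli : LinearIndependent K (fun l => Matrix.vandermonde μ l) :=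
    Matrix.linearIndependent_rows_of_det_ne_zero (Matrix.det_vandermonde_ne_zero_iff.mpr hμ)
  have htop := hli.span_eq_top_of_card_eq_finrank' (by rw [Module.finrank_fintype_fun_eq_card])
  have hmem : (fun t : Fin (M + 1) => if (t : ℕ) = p then (1 : K) else 0) ∈ Submodule.span K (Set.range fun l => Matrix.vandermonde μ l) := by
    rw [htop]; exact Submodule.mem_top
  obtain ⟨c, hc⟩ := (Submodule.mem_span_range_iff_exists_fun K).mp hmem
  refine ⟨c, fun t ht => ?_⟩
  have h := congrFun hc ⟨t, Nat.lt_succ_of_le ht⟩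
  simp only [Finset.sum_apply, Pi.smul_apply, Matrix.vandermonde_apply, smul_eq_mul] at h
  exact h

omit [Field K] in
/-- an infinite field has `m + 1` distinct elements. -/
lemma exists_injective_fin [Infinite K] (N : ℕ) : ∃ μ : Fin N → K, Function.Injective μ :=
  ⟨fun l => Infinite.natEmbedding K l, fun _ _ h => Fin.ext ((Infinite.natEmbedding K).injective h)⟩

/-- an infinite field has an element other than `0` and `1`. -/
lemma exists_ne_zero_ne_one [Infinite K] : ∃ b : K, b ≠ 0 ∧ b ≠ 1 := by
  classical
  obtain ⟨b, hb⟩ := Infinite.exists_notMem_finset ({0, 1} : Finset K)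
  simp only [Finset.mem_insert, Finset.mem_singleton, not_or] at hb
  exact ⟨b, hb.1, hb.2⟩

/-! ## §24. One factor: the transverse pairs detect the Siegel ideal -/

/-- a `k`-form killed by every transverse-pair class is killed by every GEOMETRIC class `w_m(μ^t)` (difference of two transverse pairs with the same exponentials). -/
lemma mul_w_geom_eq_zero [Infinite K] {θ : HT K (Hankel.In M)}
    (h : ∀ A B lam mu : K, A ≠ 0 → B ≠ 0 → lam ≠ mu → θ * Hankel.w K M M (tpSeq K A B lam mu) = 0) (mu : K) :
    θ * Hankel.w K M M (fun t => mu ^ t) = 0 := by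
  obtain ⟨b, hb0, hb1⟩ := exists_ne_zero_ne_one K
  have hlam : mu + 1 ≠ mu := fun e => one_ne_zero ((add_right_inj mu).mp (e.trans (add_zero mu).symm))
  have h1 := h 1 1 (mu + 1) mu one_ne_zero one_ne_zero hlam
  have h2 := h 1 b (mu + 1) mu one_ne_zero hb0 hlam
  have hdiff : θ * Hankel.w K M M ((1 - b) • fun t => mu ^ t) = 0 := by
    rw [← tpSeq_sub_tpSeq, sub_eq_add_neg, w_add, mul_add, h1, zero_add, show -tpSeq K 1 b (mu + 1) mu = (-1 : K) • tpSeq K 1 b (mu + 1) mu by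
      funext t; simp, w_smul, mul_smul_comm, h2, smul_zero]
  rw [w_smul, mul_smul_comm, smul_eq_zero] at hdiff
  exact hdiff.resolve_left (sub_ne_zero.mpr (Ne.symm hb1))

/-- … hence by every POWER `E_p = w_m(δ_p)` (Vandermonde on `m + 1` distinct elements of the infinite field). -/
lemma mul_w_spike_eq_zero_of_tp [Infinite K] {θ : HT K (Hankel.In M)}
    (h : ∀ A B lam mu : K, A ≠ 0 → B ≠ 0 → lam ≠ mu → θ * Hankel.w K M M (tpSeq K A B lam mu) = 0) (p : ℕ) :
    θ * Hankel.w K M M (fun t => if t = p then (1 : K) else 0) = 0 := by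
  obtain ⟨μ, hμ⟩ := exists_injective_fin K (M + 1)
  obtain ⟨c, hc⟩ := exists_geom_combination K hμ p
  rw [← w_congr K (fun t ht => hc t ht), w_sum, Finset.mul_sum]
  exact Finset.sum_eq_zero fun l _ => by rw [mul_smul_comm, mul_w_geom_eq_zero K h, smul_zero]

/-- **THE TRANSVERSE PAIRS DETECT THE SIEGEL IDEAL (one factor, infinite field): `θ ∈ SI_k ⟺ θ ∧ w_m(Aλ^j + Bμ^j) = 0` for all `A, B ≠ 0`, `λ ≠ μ`.** -/
theorem mem_siegelIdeal_iff_forall_tpSeq [Infinite K] {k : ℕ} {θ : HT K (Hankel.In M)} (hθ : θ ∈ ⋀[K]^k (Hankel.In M → K)) :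
    θ ∈ siegelIdeal K M k ↔ ∀ A B lam mu : K, A ≠ 0 → B ≠ 0 → lam ≠ mu → θ * Hankel.w K M M (tpSeq K A B lam mu) = 0 :=
  ⟨fun hθ' _ _ _ _ _ _ _ => mul_w_eq_zero_of_mem_siegelIdeal K hθ' _,
    fun h => (mem_siegelIdeal_iff_forall_spike K hθ).mpr fun p _ => mul_w_spike_eq_zero_of_tp K h p⟩

end OneFactor

/-! ## §25. Boxes: the transverse-pair boxes detect the box Siegel ideal -/

section Box

variable {n : ℕ} (m : Fin n → ℕ)

/-- the Hankel box only sees `(q_j)_0, …, (q_j)_{m_j}` of the updated factor. -/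
lemma hankelBox_update_congr (q : Fin n → ℕ → K) {j : ℕ} (hj : j < n) {ρ ρ' : ℕ → K} (h : ∀ t ≤ m ⟨j, hj⟩, ρ t = ρ' t) :
    hankelBox K m (Function.update q ⟨j, hj⟩ ρ) = hankelBox K m (Function.update q ⟨j, hj⟩ ρ') := by
  rw [hankelBox, hankelBox, hfac_update K m q hj, hfac_update K m q hj, w_congr K h]

/-- **the Hankel box is LINEAR in the class of each factor**: `F(q[j ↦ Σ_l c_l ρ_l]) = Σ_l c_l F(q[j ↦ ρ_l])`. -/
theorem hankelBox_update_sum (q : Fin n → ℕ → K) {j : ℕ} (hj : j < n) {ι : Type*} (s : Finset ι) (c : ι → K) (ρ : ι → ℕ → K) :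
    hankelBox K m (Function.update q ⟨j, hj⟩ fun t => ∑ l ∈ s, c l * ρ l t) = ∑ l ∈ s, c l • hankelBox K m (Function.update q ⟨j, hj⟩ (ρ l)) := by
  classical
  -- slot-linearity of the ordered product for a finset-indexed combination (induction on the finset, two-term steps via `prodR_sum_slot`)
  have key : ∀ (f : ℕ → HT K (Gen m)) (hf : f j = ∑ l ∈ s, c l • emb K (facEmb m ⟨j, hj⟩) (Hankel.w K (m ⟨j, hj⟩) (m ⟨j, hj⟩) (ρ l))),
      prodR K f n = ∑ l ∈ s, c l • prodR K (Function.update f j (emb K (facEmb m ⟨j, hj⟩) (Hankel.w K (m ⟨j, hj⟩) (m ⟨j, hj⟩) (ρ l)))) n := by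
    intro f hf
    induction s using Finset.induction_on generalizing f with
    | empty =>
      rw [Finset.sum_empty] at hf
      rw [Finset.sum_empty]
      -- a zero slot kills the whole ordered product
      have : ∀ N, j < N → prodR K f N = 0 := by
        intro N hN
        induction N with
        | zero => omega
        | succ N ih =>
          rcases Nat.lt_succ_iff_lt_or_eq.mp hN with hlt | heq
          · rw [prodR_succ, ih hlt, zero_mul]
          · subst heq; rw [prodR_succ, hf, mul_zero]
      exact this n hj
    | insert a s ha ih =>
      rw [Finset.sum_insert ha] at hf
      rw [Finset.sum_insert ha]
      -- split the slot into the first summand and the rest, using slot-linearity with a two-element index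
      have h2 := prodR_sum_slot K f (P := {0, 1}) (fun i => if i = 0 then c a else 1)
        (fun i => if i = 0 then emb K (facEmb m ⟨j, hj⟩) (Hankel.w K (m ⟨j, hj⟩) (m ⟨j, hj⟩) (ρ a))
          else ∑ l ∈ s, c l • emb K (facEmb m ⟨j, hj⟩) (Hankel.w K (m ⟨j, hj⟩) (m ⟨j, hj⟩) (ρ l)))
        (by rw [Finset.sum_pair (by norm_num), if_pos rfl, if_pos rfl, if_neg one_ne_zero, if_neg one_ne_zero, one_smul, hf]) hj
      rw [Finset.sum_pair (by norm_num), if_pos rfl, if_pos rfl, if_neg one_ne_zero, if_neg one_ne_zero, one_smul] at h2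
      rw [h2, ih (Function.update f j _) (Function.update_self _ _ _)]
      congr 1
      refine Finset.sum_congr rfl fun l _ => ?_
      rw [Function.update_idem]
  rw [hankelBox, key (hfac K m (Function.update q ⟨j, hj⟩ fun t => ∑ l ∈ s, c l * ρ l t))
    (by rw [hfac_update_self, w_sum, map_sum]; exact Finset.sum_congr rfl fun l _ => by rw [map_smul])]
  refine Finset.sum_congr rfl fun l _ => ?_
  rw [hankelBox, hfac_update K m _ hj, hfac_update K m q hj, Function.update_idem]

/-- the Hankel box is homogeneous in the class of each factor. -/
lemma hankelBox_update_smul (q : Fin n → ℕ → K) {j : ℕ} (hj : j < n) (c : K) (ρ : ℕ → K) :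
    hankelBox K m (Function.update q ⟨j, hj⟩ (c • ρ)) = c • hankelBox K m (Function.update q ⟨j, hj⟩ ρ) := by
  have h := hankelBox_update_sum K m q hj (Finset.univ : Finset Unit) (fun _ => c) (fun _ => ρ)
  rw [Fintype.sum_unique] at h
  rw [show c • ρ = fun t => ∑ _l : Unit, c * ρ t by funext t; rw [Fintype.sum_unique]; rfl, h]

/-- the Hankel box is additive in the class of each factor. -/
lemma hankelBox_update_add (q : Fin n → ℕ → K) {j : ℕ} (hj : j < n) (ρ ρ' : ℕ → K) :
    hankelBox K m (Function.update q ⟨j, hj⟩ (ρ + ρ')) = hankelBox K m (Function.update q ⟨j, hj⟩ ρ) + hankelBox K m (Function.update q ⟨j, hj⟩ ρ') := by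
  have h := hankelBox_update_sum K m q hj (Finset.univ : Finset Bool) (fun _ => (1 : K)) (fun bb => if bb then ρ else ρ')
  rw [Fintype.sum_bool, one_smul, one_smul, if_pos rfl, if_neg Bool.false_ne_true] at h
  rw [show ρ + ρ' = fun t => ∑ bb : Bool, (1 : K) * (if bb then ρ else ρ') t by
    funext t; rw [Fintype.sum_bool, if_pos rfl, if_neg Bool.false_ne_true, one_mul, one_mul]; rfl, h]

/-- the Hankel box respects differences in the class of each factor. -/
lemma hankelBox_update_sub (q : Fin n → ℕ → K) {j : ℕ} (hj : j < n) (ρ ρ' : ℕ → K) :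
    hankelBox K m (Function.update q ⟨j, hj⟩ (ρ - ρ')) = hankelBox K m (Function.update q ⟨j, hj⟩ ρ) - hankelBox K m (Function.update q ⟨j, hj⟩ ρ') := by
  rw [sub_eq_add_neg, hankelBox_update_add, show -ρ' = (-1 : K) • ρ' by funext t; simp, hankelBox_update_smul, neg_one_smul, ← sub_eq_add_neg]

/-- induction on the number of free factors: if the transverse-pair boxes kill `θ`, so does every box whose factors `≥ j` are transverse pairs. -/
lemma mul_hankelBox_eq_zero_of_tp_from [Infinite K] {θ : HT K (Gen m)}
    (h : ∀ A B lam mu : Fin n → K, (∀ i, A i ≠ 0) → (∀ i, B i ≠ 0) → (∀ i, lam i ≠ mu i) →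
      θ * hankelBox K m (fun i => tpSeq K (A i) (B i) (lam i) (mu i)) = 0) :
    ∀ (j : ℕ) (q : Fin n → ℕ → K), (∀ i : Fin n, j ≤ (i : ℕ) → ∃ A B lam mu : K, A ≠ 0 ∧ B ≠ 0 ∧ lam ≠ mu ∧ q i = tpSeq K A B lam mu) →
      θ * hankelBox K m q = 0 := by
  intro j
  induction j with
  | zero =>
    intro q hq
    choose A B lam mu hA hB hlm hq' using fun i : Fin n => hq i (Nat.zero_le _)
    have : q = fun i => tpSeq K (A i) (B i) (lam i) (mu i) := funext hq'
    rw [this]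
    exact h A B lam mu hA hB hlm
  | succ j ih =>
    intro q hq
    by_cases hj : j < n
    · -- freeze the other factors; the kernel condition in slot j is linear and holds on all transverse pairs ⇒ on geometric sequences ⇒ on δ_p ⇒ on q_j
      have hupd : ∀ ρ : ℕ → K, (∃ A B lam mu : K, A ≠ 0 ∧ B ≠ 0 ∧ lam ≠ mu ∧ ρ = tpSeq K A B lam mu) →
          θ * hankelBox K m (Function.update q ⟨j, hj⟩ ρ) = 0 := by
        intro ρ hρ
        refine ih _ fun i hi => ?_
        by_cases hij : (i : ℕ) = j
        · have : i = ⟨j, hj⟩ := Fin.ext hij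
          subst this
          rw [Function.update_self]; exact hρ
        · obtain ⟨A, B, lam, mu, hA, hB, hlm, hqi⟩ := hq i (by omega)
          exact ⟨A, B, lam, mu, hA, hB, hlm, by rw [Function.update_of_ne (fun h => hij (by simpa using congrArg Fin.val h)), hqi]⟩
      -- geometric classes in slot j: `(1 − b) μ^t = tp(1,1,μ+1,μ) − tp(1,b,μ+1,μ)`
      have hgeom : ∀ mu : K, θ * hankelBox K m (Function.update q ⟨j, hj⟩ fun t => mu ^ t) = 0 := by
        intro mu
        obtain ⟨b, hb0, hb1⟩ := exists_ne_zero_ne_one K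
        have hlam : mu + 1 ≠ mu := fun e => one_ne_zero ((add_right_inj mu).mp (e.trans (add_zero mu).symm))
        have h1 := hupd _ ⟨1, 1, mu + 1, mu, one_ne_zero, one_ne_zero, hlam, rfl⟩
        have h2 := hupd _ ⟨1, b, mu + 1, mu, one_ne_zero, hb0, hlam, rfl⟩
        have h3 : (1 - b) • (θ * hankelBox K m (Function.update q ⟨j, hj⟩ fun t => mu ^ t)) = 0 := by
          rw [← mul_smul_comm, ← hankelBox_update_smul, ← tpSeq_sub_tpSeq, hankelBox_update_sub, mul_sub, h1, h2, sub_zero]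
        exact (smul_eq_zero.mp h3).resolve_left (sub_ne_zero.mpr (Ne.symm hb1))
      -- the given class in slot j, through Vandermonde
      obtain ⟨μ, hμ⟩ := exists_injective_fin K (m ⟨j, hj⟩ + 1)
      have hq' : hankelBox K m q = hankelBox K m (Function.update q ⟨j, hj⟩ (q ⟨j, hj⟩)) := by rw [Function.update_eq_self]
      rw [hq', hankelBox_eq_sum_update K m _ hj, Finset.mul_sum]
      refine Finset.sum_eq_zero fun p _ => ?_
      rw [Function.update_idem, mul_smul_comm]
      obtain ⟨c, hc⟩ := exists_geom_combination K hμ p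
      rw [← hankelBox_update_congr K m q hj (fun t ht => hc t ht), hankelBox_update_sum, Finset.mul_sum,
        Finset.sum_eq_zero fun l _ => by rw [mul_smul_comm, hgeom, smul_zero], smul_zero]
    · exact ih q fun i _ => hq i (by have := i.2; omega)

/-- **THE TRANSVERSE-PAIR BOXES DETECT THE BOX SIEGEL IDEAL (infinite field): for `θ ∈ ⋀^k`,
`θ ∈ boxSiegelIdeal_k ⟺ θ ∧ (v₀ ∧ ⋯ ∧ v_{n−1}) = 0` for every box of transverse pairs `v_i ↔ A_i e^{λ_iΘ_i} + B_i e^{μ_iΘ_i}` (`A_i, B_i ≠ 0`, `λ_i ≠ μ_i`)** — the common kernel of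
FN-1's boxes is the box Siegel ideal, in every degree, for every number of factors and dimensions. -/
theorem mem_boxSiegelIdeal_iff_forall_tpBox [Infinite K] {k : ℕ} {θ : HT K (Gen m)} (hθ : θ ∈ ⋀[K]^k (Gen m → K)) :
    θ ∈ boxSiegelIdeal K m k ↔ ∀ A B lam mu : Fin n → K, (∀ i, A i ≠ 0) → (∀ i, B i ≠ 0) → (∀ i, lam i ≠ mu i) →
      θ * hankelBox K m (fun i => tpSeq K (A i) (B i) (lam i) (mu i)) = 0 :=
  ⟨fun h _ _ _ _ _ _ _ => mul_hankelBox_eq_zero_of_mem_boxSI K m h _,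
    fun h => (mem_boxSiegelIdeal_iff_forall_mul_hankelBox K m hθ).mpr fun q =>
      mul_hankelBox_eq_zero_of_tp_from K m h n q fun i hi => absurd i.2 (by omega)⟩

end Box

end Summit.Ventures.HSemireg.Wedge.HankelBoxSiegelIdeal
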